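import Literature.Algebra.Polynomial.CasasAlvero.Degree11CharP
import HarnessLib

/-!
# Casas-Alvero in degree 11 fails in characteristic 17

An explicit prime-field-rational Casas-Alvero polynomial of degree 11 in the depressed normal form `nf11` of `Degree11CharP.lean`,
found by random sampling of the normal form over `F_17` (`dgen/rsearch.py` of the seat-2 g4 packet: 1 hit in 2.9·10^6 samples; a hit =
an `f` whose Hasse derivatives `H_1 f, …, H_10 f` each vanish at an `F_17`-rational root of `f`).  It refutes `CA_11` over EVERY field of
characteristic `17` (a bad prime of degree 11 beyond `13` of `Degree11CharP.lean`).  [folklore]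
-/

noncomputable section

open Polynomial

namespace Literature.Algebra.Polynomial.CasasAlvero

variable (K : Type*) [Field K]

section Char17
variable [CharP K 17]

/-- `X^11 + (2) X^9 + (-4) X^8 + (6) X^7 + (-5) X^6 + (2) X^3 + (4) X^2 + (-6) X^1` is Casas-Alvero in characteristic 17 (witness roots H1↦1, H2↦-5, H3↦1, H4↦0, H5↦0, H6↦2, H7↦-5, H8↦3, H9↦-5, H10↦0). [folklore] -/
theorem isCasasAlvero_nf11_char_17 : IsCasasAlvero (nf11 K (2) (-4) (6) (-5) (0) (0) (2) (4) (-6)) := by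
  have hp : (17 : K) = 0 := by simpa using CharP.cast_eq_zero K 17
  intro i hi0 hi
  rw [natDegree_nf11] at hi
  unfold nf11
  interval_cases i
  · refine ⟨(1 : K), ?_, ?_⟩
    · simp only [eval_add, eval_pow, eval_X, eval_smul, smul_eq_mul]
      linear_combination (0 : K) * hp
    · simp only [map_add, map_smul, hasseDeriv_X_pow, eval_add, eval_mul, eval_C, eval_pow, eval_X, eval_smul, smul_eq_mul,
        show Nat.choose 11 1 = 11 from rfl, show Nat.choose 9 1 = 9 from rfl, show Nat.choose 8 1 = 8 from rfl, show Nat.choose 7 1 = 7 from rfl, show Nat.choose 6 1 = 6 from rfl, show Nat.choose 5 1 = 5 from rfl, show Nat.choose 4 1 = 4 from rfl, show Nat.choose 3 1 = 3 from rfl, show Nat.choose 2 1 = 2 from rfl, show Nat.choose 1 1 = 1 from rfl]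
      push_cast
      linear_combination (1 : K) * hp
  · refine ⟨(-5 : K), ?_, ?_⟩
    · simp only [eval_add, eval_pow, eval_X, eval_smul, smul_eq_mul]
      linear_combination (-3226110 : K) * hp
    · simp only [map_add, map_smul, hasseDeriv_X_pow, eval_add, eval_mul, eval_C, eval_pow, eval_X, eval_smul, smul_eq_mul,
        show Nat.choose 11 2 = 55 from rfl, show Nat.choose 9 2 = 36 from rfl, show Nat.choose 8 2 = 28 from rfl, show Nat.choose 7 2 = 21 from rfl, show Nat.choose 6 2 = 15 from rfl, show Nat.choose 5 2 = 10 from rfl, show Nat.choose 4 2 = 6 from rfl, show Nat.choose 3 2 = 3 from rfl, show Nat.choose 2 2 = 1 from rfl, show Nat.choose 1 2 = 0 from rfl]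
      push_cast
      linear_combination (-6778678 : K) * hp
  · refine ⟨(1 : K), ?_, ?_⟩
    · simp only [eval_add, eval_pow, eval_X, eval_smul, smul_eq_mul]
      linear_combination (0 : K) * hp
    · simp only [map_add, map_smul, hasseDeriv_X_pow, eval_add, eval_mul, eval_C, eval_pow, eval_X, eval_smul, smul_eq_mul,
        show Nat.choose 11 3 = 165 from rfl, show Nat.choose 9 3 = 84 from rfl, show Nat.choose 8 3 = 56 from rfl, show Nat.choose 7 3 = 35 from rfl, show Nat.choose 6 3 = 20 from rfl, show Nat.choose 5 3 = 10 from rfl, show Nat.choose 4 3 = 4 from rfl, show Nat.choose 3 3 = 1 from rfl, show Nat.choose 2 3 = 0 from rfl, show Nat.choose 1 3 = 0 from rfl]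
      push_cast
      linear_combination (13 : K) * hp
  · refine ⟨(0 : K), ?_, ?_⟩
    · simp only [eval_add, eval_pow, eval_X, eval_smul, smul_eq_mul]
      linear_combination (0 : K) * hp
    · simp only [map_add, map_smul, hasseDeriv_X_pow, eval_add, eval_mul, eval_C, eval_pow, eval_X, eval_smul, smul_eq_mul,
        show Nat.choose 11 4 = 330 from rfl, show Nat.choose 9 4 = 126 from rfl, show Nat.choose 8 4 = 70 from rfl, show Nat.choose 7 4 = 35 from rfl, show Nat.choose 6 4 = 15 from rfl, show Nat.choose 5 4 = 5 from rfl, show Nat.choose 4 4 = 1 from rfl, show Nat.choose 3 4 = 0 from rfl, show Nat.choose 2 4 = 0 from rfl, show Nat.choose 1 4 = 0 from rfl]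
      push_cast
      linear_combination (0 : K) * hp
  · refine ⟨(0 : K), ?_, ?_⟩
    · simp only [eval_add, eval_pow, eval_X, eval_smul, smul_eq_mul]
      linear_combination (0 : K) * hp
    · simp only [map_add, map_smul, hasseDeriv_X_pow, eval_add, eval_mul, eval_C, eval_pow, eval_X, eval_smul, smul_eq_mul,
        show Nat.choose 11 5 = 462 from rfl, show Nat.choose 9 5 = 126 from rfl, show Nat.choose 8 5 = 56 from rfl, show Nat.choose 7 5 = 21 from rfl, show Nat.choose 6 5 = 6 from rfl, show Nat.choose 5 5 = 1 from rfl, show Nat.choose 4 5 = 0 from rfl, show Nat.choose 3 5 = 0 from rfl, show Nat.choose 2 5 = 0 from rfl, show Nat.choose 1 5 = 0 from rfl]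
      push_cast
      linear_combination (0 : K) * hp
  · refine ⟨(2 : K), ?_, ?_⟩
    · simp only [eval_add, eval_pow, eval_X, eval_smul, smul_eq_mul]
      linear_combination (148 : K) * hp
    · simp only [map_add, map_smul, hasseDeriv_X_pow, eval_add, eval_mul, eval_C, eval_pow, eval_X, eval_smul, smul_eq_mul,
        show Nat.choose 11 6 = 462 from rfl, show Nat.choose 9 6 = 84 from rfl, show Nat.choose 8 6 = 28 from rfl, show Nat.choose 7 6 = 7 from rfl, show Nat.choose 6 6 = 1 from rfl, show Nat.choose 5 6 = 0 from rfl, show Nat.choose 4 6 = 0 from rfl, show Nat.choose 3 6 = 0 from rfl, show Nat.choose 2 6 = 0 from rfl, show Nat.choose 1 6 = 0 from rfl]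
      push_cast
      linear_combination (927 : K) * hp
  · refine ⟨(-5 : K), ?_, ?_⟩
    · simp only [eval_add, eval_pow, eval_X, eval_smul, smul_eq_mul]
      linear_combination (-3226110 : K) * hp
    · simp only [map_add, map_smul, hasseDeriv_X_pow, eval_add, eval_mul, eval_C, eval_pow, eval_X, eval_smul, smul_eq_mul,
        show Nat.choose 11 7 = 330 from rfl, show Nat.choose 9 7 = 36 from rfl, show Nat.choose 8 7 = 8 from rfl, show Nat.choose 7 7 = 1 from rfl, show Nat.choose 6 7 = 0 from rfl, show Nat.choose 5 7 = 0 from rfl, show Nat.choose 4 7 = 0 from rfl, show Nat.choose 3 7 = 0 from rfl, show Nat.choose 2 7 = 0 from rfl, show Nat.choose 1 7 = 0 from rfl]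
      push_cast
      linear_combination (12248 : K) * hp
  · refine ⟨(3 : K), ?_, ?_⟩
    · simp only [eval_add, eval_pow, eval_X, eval_smul, smul_eq_mul]
      linear_combination (11754 : K) * hp
    · simp only [map_add, map_smul, hasseDeriv_X_pow, eval_add, eval_mul, eval_C, eval_pow, eval_X, eval_smul, smul_eq_mul,
        show Nat.choose 11 8 = 165 from rfl, show Nat.choose 9 8 = 9 from rfl, show Nat.choose 8 8 = 1 from rfl, show Nat.choose 7 8 = 0 from rfl, show Nat.choose 6 8 = 0 from rfl, show Nat.choose 5 8 = 0 from rfl, show Nat.choose 4 8 = 0 from rfl, show Nat.choose 3 8 = 0 from rfl, show Nat.choose 2 8 = 0 from rfl, show Nat.choose 1 8 = 0 from rfl]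
      push_cast
      linear_combination (265 : K) * hp
  · refine ⟨(-5 : K), ?_, ?_⟩
    · simp only [eval_add, eval_pow, eval_X, eval_smul, smul_eq_mul]
      linear_combination (-3226110 : K) * hp
    · simp only [map_add, map_smul, hasseDeriv_X_pow, eval_add, eval_mul, eval_C, eval_pow, eval_X, eval_smul, smul_eq_mul,
        show Nat.choose 11 9 = 55 from rfl, show Nat.choose 9 9 = 1 from rfl, show Nat.choose 8 9 = 0 from rfl, show Nat.choose 7 9 = 0 from rfl, show Nat.choose 6 9 = 0 from rfl, show Nat.choose 5 9 = 0 from rfl, show Nat.choose 4 9 = 0 from rfl, show Nat.choose 3 9 = 0 from rfl, show Nat.choose 2 9 = 0 from rfl, show Nat.choose 1 9 = 0 from rfl]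
      push_cast
      linear_combination (81 : K) * hp
  · refine ⟨(0 : K), ?_, ?_⟩
    · simp only [eval_add, eval_pow, eval_X, eval_smul, smul_eq_mul]
      linear_combination (0 : K) * hp
    · simp only [map_add, map_smul, hasseDeriv_X_pow, eval_add, eval_mul, eval_C, eval_pow, eval_X, eval_smul, smul_eq_mul,
        show Nat.choose 11 10 = 11 from rfl, show Nat.choose 9 10 = 0 from rfl, show Nat.choose 8 10 = 0 from rfl, show Nat.choose 7 10 = 0 from rfl, show Nat.choose 6 10 = 0 from rfl, show Nat.choose 5 10 = 0 from rfl, show Nat.choose 4 10 = 0 from rfl, show Nat.choose 3 10 = 0 from rfl, show Nat.choose 2 10 = 0 from rfl, show Nat.choose 1 10 = 0 from rfl]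
      push_cast
      linear_combination (0 : K) * hp

end Char17

/-- `CA_11` FAILS over every field of characteristic `17`. [folklore] -/
theorem not_holdsInDegree_eleven_of_char_17 [CharP K 17] : ¬ HoldsInDegree K 11 := by
  have hq : (17 : K) = 0 := by simpa using CharP.cast_eq_zero K 17
  exact not_holdsInDegree_eleven_of_nf11 K (isCasasAlvero_nf11_char_17 K)
    (fun h => one_ne_zero (by linear_combination (-1 : K) * h - (0 : K) * hq : (1 : K) = 0))

end Literature.Algebra.Polynomial.CasasAlvero
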